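import Summits.KontsevichZagierPeriods.KontsevichZagierPeriods.Theorems.RootDecompRelativeModAbsoluteCylLogSplitP14

/-! # `RootDecompRelativeModAbsoluteCylLogSplitP15` — part 15/25 of the mechanical ≤330-line split of `CylLogSplit.lean`
(split by the decomp-kz census seat for landing; mathematics unchanged; part 15 continues part 14). -/

noncomputable section
open Set MeasureTheory Filter Topology
open scoped BigOperators
open Literature.NumberTheory.Transcendental Literature.ModelTheory.ExponentialFields

namespace Summit.KontsevichZagierPeriods.RootDecompRelativeModAbsolute.Rung30571

namespace RegularisedLogLayer

namespace CylLog
variable {b : ℕ}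

/-- **D7 for an EXACT RELATION between factors `≥ 1`** (both sides of `∏ᵢ Uᵢ = ∏ⱼ Vⱼ` written with positive
exponents; e.g. the degenerate instance §3l is `U = (W₁, W₁)`, `V = (W₁²)`): the signed sum of the regularised cells
is a BASE TERM, `Σᵢ [P_m(d,Uᵢ)] − Σⱼ [P_m(d,Vⱼ)] − [G, d·(Σᵢ polyLog_m Uᵢ − Σⱼ polyLog_m Vⱼ)] ∈ KZ.relations`
(the logarithms cancel by the relation; only the honest base condition `d·(∏Uᵢ − 1)^{m+1} ∈ L¹` is needed). -/
theorem regCells_mem_relations_of_prod_eq {b m k l : ℕ} {G : Set (Fin b → ℝ)} {d : (Fin b → ℝ) → ℝ}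
    (hGo : IsOpen G) (hG : IsSemialgebraic ℚ G) (hd : IsSemialgebraicFunOn ℚ G d)
    (U : Fin k → (Fin b → ℝ) → ℝ) (V : Fin l → (Fin b → ℝ) → ℝ)
    (hU : ∀ i, IsSemialgebraicFunOn ℚ G (U i)) (hV : ∀ j, IsSemialgebraicFunOn ℚ G (V j))
    (hUd : ∀ i, DifferentiableOn ℝ (U i) G) (hVd : ∀ j, DifferentiableOn ℝ (V j) G)
    (hU1 : ∀ i, ∀ x ∈ G, 1 ≤ U i x) (hV1 : ∀ j, ∀ x ∈ G, 1 ≤ V j x)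
    (hUV : ∀ x ∈ G, ∏ i, U i x = ∏ j, V j x)
    (hint : IntegrableOn (fun x => d x * (∏ i, U i x - 1) ^ (m + 1)) G)
    (R : Fin k → KZ.IntegralRep (b + 1)) (S : Fin l → KZ.IntegralRep (b + 1))
    (hRd : ∀ i, (R i).domain = KZlog.band G (fun _ => 1) (U i))
    (hRi : ∀ i, EqOn (R i).integrand
      (fun z => d (Fin.init z) * ((z (Fin.last b) - 1) ^ m / z (Fin.last b))) (R i).domain)
    (hSd : ∀ j, (S j).domain = KZlog.band G (fun _ => 1) (V j))
    (hSi : ∀ j, EqOn (S j).integrand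
      (fun z => d (Fin.init z) * ((z (Fin.last b) - 1) ^ m / z (Fin.last b))) (S j).domain) :
    ∃ B : KZ.IntegralRep b, B.domain = G ∧
      (B.integrand = fun x => d x * (∑ i, polyLog m (U i x) - ∑ j, polyLog m (V j x))) ∧
      ∑ i, KZ.of (R i) - ∑ j, KZ.of (S j) - KZ.of B ∈ KZ.relations := by
  have hGm : MeasurableSet G := hG.measurableSet_holds
  have hintV : IntegrableOn (fun x => d x * (∏ j, V j x - 1) ^ (m + 1)) G :=
    hint.congr_fun (fun x hx => by
      show d x * (∏ i, U i x - 1) ^ (m + 1) = d x * (∏ j, V j x - 1) ^ (m + 1)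
      rw [hUV x hx]) hGm
  obtain ⟨PU, BU, hPUd, hPUi, hBUd, hBUi, h1⟩ :=
    regTorusProductPos_iter (m := m) hGo hG hd k U hU hUd hU1 hint R hRd hRi
  obtain ⟨PV, BV, hPVd, hPVi, hBVd, hBVi, h2⟩ :=
    regTorusProductPos_iter (m := m) hGo hG hd l V hV hVd hV1 hintV S hSd hSi
  -- the two product cells coincide
  have h3 : KZ.of PU - KZ.of PV ∈ KZ.relations := by
    refine KZ.of_sub_of_mem_relations_of_eqOn ?_ (fun z _ => by rw [hPUi, hPVi])
    rw [hPVd, hPUd]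
    exact (KZlog.band_congr (a := fun _ => (1:ℝ)) fun x hx => hUV x hx).symm
  -- the base term
  have hBsa : IsSemialgebraicFunOn ℚ G
      (fun x => d x * (∑ i, polyLog m (U i x) - ∑ j, polyLog m (V j x))) :=
    IsSemialgebraicFunOn.mul_holds hd (IsSemialgebraicFunOn.sub_holds
      (KZ.isSemialgebraicFunOn_finset_sum Finset.univ hG fun i _ =>
        isSemialgebraicFunOn_polyLog_comp hG (hU i) m)
      (KZ.isSemialgebraicFunOn_finset_sum Finset.univ hG fun j _ =>
        isSemialgebraicFunOn_polyLog_comp hG (hV j) m))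
  have hsum : ∀ x ∈ G, BV.integrand x =
      d x * (∑ i, polyLog m (U i x) - ∑ j, polyLog m (V j x)) + BU.integrand x := by
    intro x hx
    rw [hBVi, hBUi]
    simp only
    rw [← hUV x hx]
    ring
  have hBU_int : IntegrableOn BU.integrand G := by
    have h := BU.integrableOn
    rwa [hBUd] at h
  have hBV_int : IntegrableOn BV.integrand G := by
    have h := BV.integrableOn
    rwa [hBVd] at h
  have hBint : IntegrableOn (fun x => d x * (∑ i, polyLog m (U i x) - ∑ j, polyLog m (V j x))) G :=
    (hBV_int.sub hBU_int).congr_fun (fun x hx => by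
      show BV.integrand x - BU.integrand x = d x * (∑ i, polyLog m (U i x) - ∑ j, polyLog m (V j x))
      rw [hsum x hx]
      ring) hGm
  set B : KZ.IntegralRep b :=
    { domain := G
      integrand := fun x => d x * (∑ i, polyLog m (U i x) - ∑ j, polyLog m (V j x))
      isSemialgebraic_domain := hG
      isSemialgebraicFunOn_integrand := hBsa
      integrableOn := hBint } with hB
  have h4 : KZ.of BV - KZ.of B - KZ.of BU ∈ KZ.relations :=
    KZ.integrandAddRel_subset_relations ⟨b, BV, B, BU, hBVd.symm, hBUd.trans hBVd.symm,
      fun x hx => by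
        rw [hBVd] at hx
        exact hsum x hx, rfl⟩
  refine ⟨B, rfl, rfl, ?_⟩
  have e : ∑ i, KZ.of (R i) - ∑ j, KZ.of (S j) - KZ.of B =
      (KZ.of PV - ∑ j, KZ.of (S j) - KZ.of BV) - (KZ.of PU - ∑ i, KZ.of (R i) - KZ.of BU) +
        (KZ.of PU - KZ.of PV) + (KZ.of BV - KZ.of B - KZ.of BU) := by
    abel
  rw [e]
  exact add_mem (add_mem (sub_mem h2 h1) h3) h4

/-! ### §3q D7 IN LEAN (reversed orientation): factors in `(0,1]` — PROVED
Mirror of §3p for reversed cells `P⁻_m(d,W) = [band G W 1, d (t−1)^m/t]` (`0 < W ≤ 1`), using the `Neg` pattern; the honest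
base condition is `d·(1 − ∏Wᵢ)^{m+1}/∏Wᵢ ∈ L¹(G)`; plus the defect bounds needed at a MIXED junction (§3r). -/

/-- Auxiliary step `gneg_mono`. [bookkeeping] -/
theorem gneg_mono (m : ℕ) {s t : ℝ} (ht : 0 < t) (hts : t ≤ s) (hs1 : s ≤ 1) :
    (1 - s) ^ (m + 1) / s ≤ (1 - t) ^ (m + 1) / t := by
  have hs : 0 < s := ht.trans_le hts
  calc (1 - s) ^ (m + 1) / s ≤ (1 - t) ^ (m + 1) / s :=
        div_le_div_of_nonneg_right (pow_le_pow_left₀ (by linarith) (by linarith) _) hs.le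
    _ ≤ (1 - t) ^ (m + 1) / t :=
        div_le_div_of_nonneg_left (pow_nonneg (by linarith) _) ht hts

/-- Auxiliary step `abs_integral_regKernel_le_neg`. [bookkeeping] -/
theorem abs_integral_regKernel_le_neg (m : ℕ) {w : ℝ} (hw0 : 0 < w) (hw1 : w ≤ 1) :
    |∫ t in (1:ℝ)..w, (t - 1) ^ m / t| ≤ (1 - w) ^ (m + 1) / w := by
  have hbound : ∀ t ∈ Set.uIoc (1:ℝ) w, ‖((t - 1) ^ m / t : ℝ)‖ ≤ (1 - w) ^ m / w := by
    intro t ht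
    rw [Set.uIoc_of_ge hw1] at ht
    have ht0 : 0 < t := hw0.trans ht.1
    rw [Real.norm_eq_abs, abs_div, abs_of_pos ht0, abs_pow, abs_of_nonpos (by linarith [ht.2]),
      neg_sub]
    calc (1 - t) ^ m / t ≤ (1 - w) ^ m / t :=
          div_le_div_of_nonneg_right
            (pow_le_pow_left₀ (by linarith [ht.2]) (by linarith [ht.1]) _) ht0.le
      _ ≤ (1 - w) ^ m / w := div_le_div_of_nonneg_left (pow_nonneg (by linarith) _) hw0 ht.1.le
  have h := intervalIntegral.norm_integral_le_of_norm_le_const hbound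
  rw [Real.norm_eq_abs] at h
  calc |∫ t in (1:ℝ)..w, (t - 1) ^ m / t| ≤ (1 - w) ^ m / w * |w - 1| := h
    _ = (1 - w) ^ (m + 1) / w := by
        rw [abs_of_nonpos (by linarith), neg_sub, pow_succ]
        ring

/-- `|ρ_m(u,w)| ≤ 3·(1−uw)^{m+1}/(uw)` for `u, w ∈ (0,1]`. -/
theorem abs_rho_le_neg (m : ℕ) {u w : ℝ} (hu0 : 0 < u) (hu1 : u ≤ 1) (hw0 : 0 < w) (hw1 : w ≤ 1) :
    |rho m u w| ≤ 3 * ((1 - u * w) ^ (m + 1) / (u * w)) := by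
  have huw0 : 0 < u * w := mul_pos hu0 hw0
  have huw_u : u * w ≤ u := mul_le_of_le_one_right hu0.le hw1
  have huw_w : u * w ≤ w := mul_le_of_le_one_left hw0.le hu1
  have huw1 : u * w ≤ 1 := huw_u.trans hu1
  rw [← integral_reg_kernel_mul m hu0 hw0]
  have h1 := abs_le.mp (abs_integral_regKernel_le_neg m huw0 huw1)
  have h2 := abs_le.mp ((abs_integral_regKernel_le_neg m hu0 hu1).trans
    (gneg_mono m huw0 huw_u hu1))
  have h3 := abs_le.mp ((abs_integral_regKernel_le_neg m hw0 hw1).trans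
    (gneg_mono m huw0 huw_w hw1))
  rw [abs_le]
  constructor <;> linarith [h1.1, h1.2, h2.1, h2.2, h3.1, h3.2]

/-- `|ρ_m(u,w)| ≤ 2·((u−1)^{m+1} + (1−w)^{m+1}/w)` for `u ≥ 1`, `w ∈ (0,1]` (either orientation of `uw`). -/
theorem abs_rho_le_mixed (m : ℕ) {u w : ℝ} (hu1 : 1 ≤ u) (hw0 : 0 < w) (hw1 : w ≤ 1) :
    |rho m u w| ≤ 2 * ((u - 1) ^ (m + 1) + (1 - w) ^ (m + 1) / w) := by
  have hu0 : 0 < u := by linarith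
  have huw0 : 0 < u * w := mul_pos hu0 hw0
  have huw_u : u * w ≤ u := mul_le_of_le_one_right hu0.le hw1
  have hw_uw : w ≤ u * w := le_mul_of_one_le_left hw0.le hu1
  have hg0 : 0 ≤ (1 - w) ^ (m + 1) / w := div_nonneg (pow_nonneg (by linarith) _) hw0.le
  have hp0 : 0 ≤ (u - 1) ^ (m + 1) := pow_nonneg (by linarith) _
  rw [← integral_reg_kernel_mul m hu0 hw0]
  have hA0 := integral_regKernel_nonneg m hu1
  have hA1 := integral_regKernel_le_pow m hu1
  have h3 := abs_le.mp (abs_integral_regKernel_le_neg m hw0 hw1)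
  have hI : |∫ t in (1:ℝ)..(u * w), (t - 1) ^ m / t| ≤
      (u - 1) ^ (m + 1) + (1 - w) ^ (m + 1) / w := by
    by_cases huw : 1 ≤ u * w
    · have hm := integral_regKernel_mono m huw huw_u
      have h0 := integral_regKernel_nonneg m huw
      rw [abs_of_nonneg h0]
      linarith
    · have huw' : u * w ≤ 1 := (not_le.mp huw).le
      have hle := (abs_integral_regKernel_le_neg m huw0 huw').trans (gneg_mono m hw0 hw_uw huw')
      linarith
  have hI' := abs_le.mp hI
  rw [abs_le]
  constructor <;> linarith [hI'.1, hI'.2, h3.1, h3.2]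

/-- **Existence of the base term** `[G, d·ρ_m(u,w)]` for `u, w ∈ (0,1]` from `d·(1−uw)^{m+1}/(uw) ∈ L¹(G)`. -/
theorem exists_baseRep_rho_neg {b m : ℕ} {G : Set (Fin b → ℝ)} {d u w : (Fin b → ℝ) → ℝ}
    (hG : IsSemialgebraic ℚ G) (hd : IsSemialgebraicFunOn ℚ G d) (hu : IsSemialgebraicFunOn ℚ G u)
    (hw : IsSemialgebraicFunOn ℚ G w) (hu0 : ∀ x ∈ G, 0 < u x) (hu1 : ∀ x ∈ G, u x ≤ 1)
    (hw0 : ∀ x ∈ G, 0 < w x) (hw1 : ∀ x ∈ G, w x ≤ 1)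
    (hint : IntegrableOn (fun x => d x * (1 - u x * w x) ^ (m + 1) / (u x * w x)) G) :
    ∃ B : KZ.IntegralRep b, B.domain = G ∧ B.integrand = fun x => d x * rho m (u x) (w x) := by
  have hGm : MeasurableSet G := hG.measurableSet_holds
  have hsa : IsSemialgebraicFunOn ℚ G (fun x => d x * rho m (u x) (w x)) :=
    (IsSemialgebraicFunOn.mul_holds hd
      (IsSemialgebraicFunOn.sub_holds (IsSemialgebraicFunOn.sub_holds
        (isSemialgebraicFunOn_polyLog_comp hG (IsSemialgebraicFunOn.mul_holds hu hw) m)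
        (isSemialgebraicFunOn_polyLog_comp hG hu m))
        (isSemialgebraicFunOn_polyLog_comp hG hw m))).congr fun x _ => by simp [rho]
  have hKn : IntegrableOn (fun x => 3 * ‖d x * (1 - u x * w x) ^ (m + 1) / (u x * w x)‖) G :=
    hint.norm.const_mul 3
  have hB : IntegrableOn (fun x => d x * rho m (u x) (w x)) G := by
    refine Integrable.mono' hKn (KZ.aestronglyMeasurable_of_isSemialgebraicFunOn hsa hGm) ?_
    filter_upwards [ae_restrict_mem hGm] with x hx
    have huw0 : 0 < u x * w x := mul_pos (hu0 x hx) (hw0 x hx)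
    have h1 : u x * w x ≤ 1 := (mul_le_of_le_one_right (hu0 x hx).le (hw1 x hx)).trans (hu1 x hx)
    rw [Real.norm_eq_abs, Real.norm_eq_abs, abs_mul, mul_div_assoc, abs_mul,
      abs_of_nonneg (div_nonneg (pow_nonneg (sub_nonneg.mpr h1) (m + 1)) huw0.le)]
    have h := abs_rho_le_neg m (hu0 x hx) (hu1 x hx) (hw0 x hx) (hw1 x hx)
    calc |d x| * |rho m (u x) (w x)| ≤ |d x| * (3 * ((1 - u x * w x) ^ (m + 1) / (u x * w x))) :=
          mul_le_mul_of_nonneg_left h (abs_nonneg _)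
      _ = 3 * (|d x| * ((1 - u x * w x) ^ (m + 1) / (u x * w x))) := by ring
  exact ⟨{ domain := G, integrand := fun x => d x * rho m (u x) (w x), isSemialgebraic_domain := hG,
           isSemialgebraicFunOn_integrand := hsa, integrableOn := hB }, rfl, rfl⟩

/-- **Existence of the base term** `[G, d·ρ_m(u,w)]` for `u ≥ 1`, `w ∈ (0,1]` from the two one-sided bounds. -/
theorem exists_baseRep_rho_mixed {b m : ℕ} {G : Set (Fin b → ℝ)} {d u w : (Fin b → ℝ) → ℝ}
    (hG : IsSemialgebraic ℚ G) (hd : IsSemialgebraicFunOn ℚ G d) (hu : IsSemialgebraicFunOn ℚ G u)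
    (hw : IsSemialgebraicFunOn ℚ G w) (hu1 : ∀ x ∈ G, 1 ≤ u x)
    (hw0 : ∀ x ∈ G, 0 < w x) (hw1 : ∀ x ∈ G, w x ≤ 1)
    (hintu : IntegrableOn (fun x => d x * (u x - 1) ^ (m + 1)) G)
    (hintw : IntegrableOn (fun x => d x * (1 - w x) ^ (m + 1) / w x) G) :
    ∃ B : KZ.IntegralRep b, B.domain = G ∧ B.integrand = fun x => d x * rho m (u x) (w x) := by
  have hGm : MeasurableSet G := hG.measurableSet_holds
  have hsa : IsSemialgebraicFunOn ℚ G (fun x => d x * rho m (u x) (w x)) :=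
    (IsSemialgebraicFunOn.mul_holds hd
      (IsSemialgebraicFunOn.sub_holds (IsSemialgebraicFunOn.sub_holds
        (isSemialgebraicFunOn_polyLog_comp hG (IsSemialgebraicFunOn.mul_holds hu hw) m)
        (isSemialgebraicFunOn_polyLog_comp hG hu m))
        (isSemialgebraicFunOn_polyLog_comp hG hw m))).congr fun x _ => by simp [rho]
  have hKn : IntegrableOn (fun x => 2 * (‖d x * (u x - 1) ^ (m + 1)‖ +
      ‖d x * (1 - w x) ^ (m + 1) / w x‖)) G :=
    (hintu.norm.add hintw.norm).const_mul 2
  have hB : IntegrableOn (fun x => d x * rho m (u x) (w x)) G := by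
    refine Integrable.mono' hKn (KZ.aestronglyMeasurable_of_isSemialgebraicFunOn hsa hGm) ?_
    filter_upwards [ae_restrict_mem hGm] with x hx
    rw [Real.norm_eq_abs, Real.norm_eq_abs, Real.norm_eq_abs, abs_mul, abs_mul, mul_div_assoc, abs_mul,
      abs_of_nonneg (pow_nonneg (sub_nonneg.mpr (hu1 x hx)) (m + 1)),
      abs_of_nonneg (div_nonneg (pow_nonneg (sub_nonneg.mpr (hw1 x hx)) (m + 1)) (hw0 x hx).le)]
    have h := abs_rho_le_mixed m (hu1 x hx) (hw0 x hx) (hw1 x hx)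
    calc |d x| * |rho m (u x) (w x)|
        ≤ |d x| * (2 * ((u x - 1) ^ (m + 1) + (1 - w x) ^ (m + 1) / w x)) :=
          mul_le_mul_of_nonneg_left h (abs_nonneg _)
      _ = 2 * (|d x| * (u x - 1) ^ (m + 1) + |d x| * ((1 - w x) ^ (m + 1) / w x)) := by ring
  exact ⟨{ domain := G, integrand := fun x => d x * rho m (u x) (w x), isSemialgebraic_domain := hG,
           isSemialgebraicFunOn_integrand := hsa, integrableOn := hB }, rfl, rfl⟩

/-- Auxiliary step `fin_prod_pos'`. [bookkeeping] -/
theorem fin_prod_pos' {k : ℕ} {a : Fin k → ℝ} (h : ∀ i, 0 < a i) : 0 < ∏ i, a i :=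
  Finset.prod_pos fun i _ => h i

/-- Auxiliary step `fin_prod_le_one'`. [bookkeeping] -/
theorem fin_prod_le_one' {k : ℕ} {a : Fin k → ℝ} (h0 : ∀ i, 0 < a i) (h1 : ∀ i, a i ≤ 1) :
    ∏ i, a i ≤ 1 :=
  Finset.prod_le_one (fun i _ => (h0 i).le) fun i _ => h1 i

end CylLog
end RegularisedLogLayer
end Summit.KontsevichZagierPeriods.RootDecompRelativeModAbsolute.Rung30571
end
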